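import Literature.Combinatorics.Matroid.RadoIndependentTransversal
import Literature.Computability.MetaComplexity.AffineClauseSystems

/-!
# PneNP / ReslinSizeFromWidth — the linear Aharoni–Linial lemma (helper for stmt-PneNP-18934)

Support item stmt-PneNP-18934 (`WidthFromVertexExpansion`: cover expansion forces Res(⊕) rank).
Affine replacements of Jukna 2012, Claims 18.20–18.22 (whose resolution version is Thm 18.19 =
Ben-Sasson–Wigderson 2001), over `Literature.Computability.MetaComplexity.AffineClauseSystems`:
* `transversal_criterion` — if the Rado deficiency `δ_S(K)` (`S = ⟨L(Ψ)⟩`) is `≤ 0` for all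
  `K ⊆ X`, the clause set `X` is satisfiable together with the consistent system `Ψ` (Rado's
  theorem `Literature.Combinatorics.Matroid.rado_vector_space` in `𝔽₂^V/⟨L(Ψ)⟩` + `extend_family`);
* `linear_aharoni_linial` — a minimally `Ψ`-unsatisfiable `X` has `δ_S(X) ≥ 1`, uniquely among its
  subsets (critical-set argument); rank form `card_VI_succ_le_card_add_finrank`:
  `|V(X)| + 1 ≤ |X| + dim ⟨L(Ψ)⟩`.
-- adapted from reserve/prior-2001/Prior/PneNP/PneNP/Pnp_Ac0pFregeViaAlgebraicProofs_SafeWalkLAL.lean (§5)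
References: S. Jukna, *Boolean Function Complexity* (2012), §18.8; R. Aharoni, N. Linial, JCTA 43
(1986); R. Rado, Quart. J. Math. 13 (1942); K. Efremenko, M. Garlík, D. Itsykson, STOC 2024, §2.1.
-/

namespace Summit.PneNP.PneNP.Theorems

-- `Summit.PneNP.PneNP` repeats a path component by design (summit = sub-problem); silence the linter.
set_option linter.dupNamespace false

namespace ResLinRank

open Finset Submodule Module Literature.Computability.MetaComplexity
open Literature.Computability.MetaComplexity.AffSys

variable {V : Type*} [Fintype V] [DecidableEq V]

/-! ### Generic linear-algebra bookkeeping -/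

omit [Fintype V] [DecidableEq V] in
/-- Span of a `Finset.biUnion`, as a `Finset.sup` of spans. -/
theorem span_biUnion {α : Type*} [DecidableEq α] {M : Type*} [AddCommGroup M]
    [Module (ZMod 2) M] [DecidableEq M] (s : Finset α) (g : α → Finset M) :
    Submodule.span (ZMod 2) ((s.biUnion g : Finset M) : Set M) =
      s.sup (fun j => Submodule.span (ZMod 2) ((g j : Finset M) : Set M)) := by
  classical
  induction s using Finset.induction_on with
  | empty => simp
  | insert a s ha ih =>
      rw [Finset.biUnion_insert, Finset.coe_union, Submodule.span_union, ih,
        Finset.sup_insert]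

omit [Fintype V] [DecidableEq V] in
/-- `Submodule.map` commutes with `Finset.sup`. -/
theorem map_finsetSup {α : Type*} {M N : Type*} [AddCommGroup M] [Module (ZMod 2) M]
    [AddCommGroup N] [Module (ZMod 2) N] (φ : M →ₗ[ZMod 2] N) (s : Finset α)
    (p : α → Submodule (ZMod 2) M) :
    Submodule.map φ (s.sup p) = s.sup (fun j => Submodule.map φ (p j)) := by
  classical
  induction s using Finset.induction_on with
  | empty => simp
  | insert a s ha ih => rw [Finset.sup_insert, Submodule.map_sup, ih, Finset.sup_insert]

/-- Rank–nullity bridge: the image of `𝔽₂^A` in `𝔽₂^V / S` has dimension `|A| - dim(S ∩ 𝔽₂^A)`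
(the rank of the variable set `A` in the quotient matroid `𝔽₂^V/S`). -/
theorem finrank_map_mkQ_coordS (S : Submodule (ZMod 2) (V → ZMod 2)) (A : Finset V) :
    finrank (ZMod 2) ((coordS A).map S.mkQ) +
      finrank (ZMod 2) (S ⊓ coordS A : Submodule (ZMod 2) (V → ZMod 2)) = A.card := by
  have h := LinearMap.finrank_range_add_finrank_ker (S.mkQ.comp (coordS A).subtype)
  rw [LinearMap.range_comp, Submodule.range_subtype, LinearMap.ker_comp,
    Submodule.ker_mkQ] at h
  have hker : finrank (ZMod 2) (Submodule.comap (coordS A).subtype S) =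
      finrank (ZMod 2) (S ⊓ coordS A : Submodule (ZMod 2) (V → ZMod 2)) := by
    have heq : Submodule.comap (coordS A).subtype S =
        Submodule.comap (coordS A).subtype (S ⊓ coordS A) := by
      ext x
      simp only [Submodule.mem_comap, Submodule.mem_inf]
      exact ⟨fun hx => ⟨hx, x.2⟩, fun hx => hx.1⟩
    rw [heq,
      (Submodule.comapSubtypeEquivOfLe (inf_le_right : S ⊓ coordS A ≤ coordS A)).finrank_eq]
  rw [hker, finrank_coordS] at h
  exact h

/-! ### Prescribing values of forms independent modulo `⟨L(Ψ)⟩` -/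

omit [DecidableEq V] in
/-- ITERATED ONE-STEP EXTENSION: a finite family of forms `g j` that is linearly independent
modulo `⟨L(Ψ)⟩` (i.e. independent in `𝔽₂^V/⟨L(Ψ)⟩`) can be given arbitrary prescribed values
`b j` by a solution of the consistent system `Ψ`. -/
theorem extend_family {Ψ : AffSys V} (hcons : (Sol Ψ).Nonempty)
    {ι : Type*} [Fintype ι] [DecidableEq ι] (g : ι → V → ZMod 2) (b : ι → ZMod 2)
    (hli : LinearIndependent (ZMod 2) (fun j => (spanS Ψ).mkQ (g j))) :
    ∃ z ∈ Sol Ψ, ∀ j, g j ⬝ᵥ z = b j := by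
  classical
  have main : ∀ s : Finset ι,
      (Sol (Ψ ∪ s.image (fun j => (g j, b j)))).Nonempty ∧
      spanS (Ψ ∪ s.image (fun j => (g j, b j))) =
        spanS Ψ ⊔ Submodule.span (ZMod 2) ((s.image g : Finset (V → ZMod 2)) : Set (V → ZMod 2)) := by
    intro s
    induction s using Finset.induction_on with
    | empty =>
      refine ⟨by simpa using hcons, ?_⟩
      rw [Finset.image_empty, Finset.union_empty, Finset.image_empty]
      simp
    | insert j s hjs ih =>
      obtain ⟨ihcons, ihspan⟩ := ih
      have hsplit : Ψ ∪ (insert j s).image (fun j => (g j, b j)) =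
          (Ψ ∪ s.image (fun j => (g j, b j))) ∪ {(g j, b j)} := by
        ext p
        simp only [Finset.mem_union, Finset.mem_image, Finset.mem_insert,
          Finset.mem_singleton]
        constructor
        · rintro (hp | ⟨i, (rfl | hi), rfl⟩)
          · exact Or.inl (Or.inl hp)
          · exact Or.inr rfl
          · exact Or.inl (Or.inr ⟨i, hi, rfl⟩)
        · rintro ((hp | ⟨i, hi, rfl⟩) | rfl)
          · exact Or.inl hp
          · exact Or.inr ⟨i, Or.inr hi, rfl⟩
          · exact Or.inr ⟨j, Or.inl rfl, rfl⟩
      -- the new form is outside the current span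
      have hnot : g j ∉ spanS (Ψ ∪ s.image (fun j => (g j, b j))) := by
        rw [ihspan]
        intro hmem
        have hq : (spanS Ψ).mkQ (g j) ∈
            Submodule.span (ZMod 2)
              ((fun i => (spanS Ψ).mkQ (g i)) '' (s : Set ι)) := by
          have h1 : (spanS Ψ).mkQ (g j) ∈
              Submodule.map (spanS Ψ).mkQ
                (spanS Ψ ⊔ Submodule.span (ZMod 2)
                  ((s.image g : Finset (V → ZMod 2)) : Set (V → ZMod 2))) :=
            Submodule.mem_map_of_mem hmem
          rw [Submodule.map_sup] at h1
          have hbot : Submodule.map (spanS Ψ).mkQ (spanS Ψ) = ⊥ := by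
            rw [Submodule.eq_bot_iff]
            rintro q ⟨y, hy, rfl⟩
            exact (Submodule.Quotient.mk_eq_zero _).mpr hy
          rw [hbot, bot_sup_eq] at h1
          have himg2 : Submodule.map (spanS Ψ).mkQ
              (Submodule.span (ZMod 2) ((s.image g : Finset (V → ZMod 2)) : Set (V → ZMod 2))) =
              Submodule.span (ZMod 2)
                ((fun i => (spanS Ψ).mkQ (g i)) '' (s : Set ι)) := by
            rw [← Submodule.span_image]
            congr 1
            rw [Finset.coe_image, ← Set.image_comp]
            rfl
          rw [himg2] at h1
          exact h1
        exact hli.notMem_span_image (Finset.mem_coe.not.mpr hjs) hq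
      have hcons' := extend_consistent ihcons hnot (b j)
      constructor
      · rw [hsplit]
        exact hcons'
      · rw [hsplit, spanS_union]
        rw [ihspan]
        have hsingle : spanS ({(g j, b j)} : AffSys V) =
            Submodule.span (ZMod 2) ({g j} : Set (V → ZMod 2)) := by
          unfold spanS forms
          rw [Finset.image_singleton, Finset.coe_singleton]
        rw [hsingle]
        have himg : ((insert j s).image g : Finset (V → ZMod 2)) =
            insert (g j) (s.image g) := Finset.image_insert _ _ _
        rw [himg, Finset.coe_insert, Submodule.span_insert, sup_assoc,
          sup_comm (Submodule.span (ZMod 2) ((s.image g : Finset (V → ZMod 2)) : Set (V → ZMod 2)))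
            (Submodule.span (ZMod 2) ({g j} : Set (V → ZMod 2)))]
  obtain ⟨⟨z, hz⟩, _⟩ := main Finset.univ
  refine ⟨z, ?_, ?_⟩
  · intro p hp
    exact hz p (Finset.mem_union_left _ hp)
  · intro j
    exact hz (g j, b j)
      (Finset.mem_union_right _ (Finset.mem_image_of_mem _ (Finset.mem_univ j)))

/-! ### The transversal criterion and the linear Aharoni–Linial lemma -/

section CriterionLAL

variable {ι : Type*} [DecidableEq ι] (T : ι → Finset V) (a : ι → V → ZMod 2)

omit [DecidableEq V] in
/-- A form supported in `A` only sees the coordinates in `A`. -/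
theorem dotProduct_congr_on {A : Finset V} {f : V → ZMod 2} (hf : f ∈ coordS A) (z w : V → ZMod 2)
    (h : ∀ i ∈ A, z i = w i) : f ⬝ᵥ z = f ⬝ᵥ w := by
  unfold dotProduct
  refine Finset.sum_congr rfl (fun i _ => ?_)
  by_cases hi : i ∈ A
  · rw [h i hi]
  · rw [hf i hi, zero_mul, zero_mul]

/-- TRANSVERSAL CRITERION (affine Claim 18.20 of Jukna 2012): if `δ_{⟨L(Ψ)⟩}(K) ≤ 0` for every
`K ⊆ X`, then the clause set `X` is satisfiable by a solution of the consistent system `Ψ`.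
Rado's theorem in `𝔽₂^V/⟨L(Ψ)⟩` + `extend_family`. -/
theorem transversal_criterion (Ψ : AffSys V) (hcons : (Sol Ψ).Nonempty)
    (X : Finset ι)
    (hdef : ∀ K ⊆ X, deltaS T (spanS Ψ) K ≤ 0) : PsiSat T a Ψ X := by
  classical
  set S := spanS Ψ with hS
  set Afam : {x // x ∈ X} → Finset ((V → ZMod 2) ⧸ S) :=
    fun j => (Finset.univ.filter (· ∈ coordS (T j.1))).image S.mkQ with hAfam
  have hadm : ∀ s : Finset {x // x ∈ X},
      s.card ≤ finrank (ZMod 2)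
        (Submodule.span (ZMod 2)
          ((s.biUnion Afam : Finset ((V → ZMod 2) ⧸ S)) : Set ((V → ZMod 2) ⧸ S))) := by
    intro s
    set K' : Finset ι := s.image Subtype.val with hK'
    have hK'sub : K' ⊆ X := by
      intro j hj
      rw [hK', Finset.mem_image] at hj
      obtain ⟨j', _, rfl⟩ := hj
      exact j'.2
    have hcards : K'.card = s.card := Finset.card_image_of_injective _ Subtype.val_injective
    -- span of the biUnion is the image of the coordinate subspace of V(K')
    have hspan : Submodule.span (ZMod 2)
        ((s.biUnion Afam : Finset ((V → ZMod 2) ⧸ S)) : Set ((V → ZMod 2) ⧸ S)) =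
        Submodule.map S.mkQ (coordS (VI T K')) := by
      rw [span_biUnion]
      have hone : ∀ j : {x // x ∈ X},
          Submodule.span (ZMod 2) ((Afam j : Finset ((V → ZMod 2) ⧸ S)) :
            Set ((V → ZMod 2) ⧸ S)) = Submodule.map S.mkQ (coordS (T j.1)) := by
        intro j
        rw [hAfam, Finset.coe_image, Submodule.span_image]
        congr 1
        apply Submodule.span_eq_of_le
        · intro v hv
          rw [Finset.mem_coe, Finset.mem_filter] at hv
          exact hv.2
        · intro v hv
          exact Submodule.subset_span (Finset.mem_coe.mpr
            (Finset.mem_filter.mpr ⟨Finset.mem_univ v, hv⟩))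
      calc s.sup (fun j => Submodule.span (ZMod 2)
            ((Afam j : Finset ((V → ZMod 2) ⧸ S)) : Set ((V → ZMod 2) ⧸ S)))
          = s.sup (fun j => Submodule.map S.mkQ (coordS (T j.1))) := by
            exact Finset.sup_congr rfl (fun j _ => hone j)
        _ = Submodule.map S.mkQ (s.sup (fun j => coordS (T j.1))) :=
            (map_finsetSup S.mkQ s _).symm
        _ = Submodule.map S.mkQ (coordS (VI T K')) := by
            congr 1
            rw [VI, coordS_biUnion]
            rw [hK', Finset.sup_image]
            rfl
    rw [hspan]
    -- rank–nullity turns the deficiency bound into the admissibility bound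
    have hrn := finrank_map_mkQ_coordS S (VI T K')
    have hd := hdef K' hK'sub
    rw [deltaS] at hd
    omega
  obtain ⟨e, he, hli⟩ := Literature.Combinatorics.Matroid.rado_vector_space Afam hadm
  -- pull the transversal back to forms g j ∈ 𝔽₂^{T j}
  have hpull : ∀ j : {x // x ∈ X}, ∃ gj : V → ZMod 2, gj ∈ coordS (T j.1) ∧ S.mkQ gj = e j := by
    intro j
    have := he j
    rw [hAfam, Finset.mem_image] at this
    obtain ⟨gj, hgj, hq⟩ := this
    rw [Finset.mem_filter] at hgj
    exact ⟨gj, hgj.2, hq⟩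
  choose g hg hq using hpull
  have hli' : LinearIndependent (ZMod 2) (fun j => S.mkQ (g j)) := by
    have : (fun j => S.mkQ (g j)) = e := funext hq
    rw [this]
    exact hli
  -- prescribe the values ⟨g j, a j⟩ + 1
  obtain ⟨z, hzSol, hzval⟩ := extend_family hcons g
    (fun j => g j ⬝ᵥ a j.1 + 1) hli'
  refine ⟨z, hzSol, ?_⟩
  intro j hj
  by_contra hcontra
  push Not at hcontra
  have hagree : ∀ i ∈ T j, z i = a j i := hcontra
  have := hzval ⟨j, hj⟩
  rw [dotProduct_congr_on (hg ⟨j, hj⟩) z (a j) hagree] at this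
  have hone : ∀ x : ZMod 2, x ≠ x + 1 := by decide
  exact hone _ this

/-- **The linear Aharoni–Linial lemma** (affine Tarsi lemma; affine Claims 18.21–18.22 of Jukna
2012): if `Ψ` is a consistent affine system with form span `S = ⟨L(Ψ)⟩` and the clause set `X` is
minimally `Ψ`-unsatisfiable, then `δ_S(X) ≥ 1`, and `δ_S(J) ≤ δ_S(X) - 1` for every proper subset
`J ⊊ X`. -/
theorem linear_aharoni_linial (Ψ : AffSys V) (hcons : (Sol Ψ).Nonempty)
    (X : Finset ι) (hmin : MinimalPsiUnsat T a Ψ X) :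
    1 ≤ deltaS T (spanS Ψ) X ∧
      ∀ J ⊂ X, deltaS T (spanS Ψ) J ≤ deltaS T (spanS Ψ) X - 1 := by
  classical
  set S := spanS Ψ with hS
  -- Step 1: every maximiser of δ_S over subsets of X is Ψ-unsatisfiable
  have key : ∀ I ∈ X.powerset,
      (∀ J ∈ X.powerset, deltaS T S J ≤ deltaS T S I) → ¬ PsiSat T a Ψ I := by
    intro I hI hImax hIsat
    have hIX : I ⊆ X := Finset.mem_powerset.mp hI
    obtain ⟨z, hzSol, hzSat⟩ := hIsat
    -- extend Ψ by the assignment equations on V(I)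
    set E : AffSys V := (VI T I).image (fun i => (Pi.single i 1, z i)) with hE
    set Ψ' : AffSys V := Ψ ∪ E with hΨ'
    have hz' : z ∈ Sol Ψ' := by
      rw [hΨ', Sol_union]
      refine ⟨hzSol, ?_⟩
      intro p hp
      rw [hE, Finset.mem_image] at hp
      obtain ⟨i, _, rfl⟩ := hp
      rw [single_dotProduct, one_mul]
    have hspan' : spanS Ψ' = S ⊔ coordS (VI T I) := by
      rw [hΨ', spanS_union, hS]
      congr 1
      unfold spanS
      rw [hE]
      have himg : forms ((VI T I).image (fun i => (Pi.single i 1, z i))) =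
          (VI T I).image (fun i => Pi.single i (1 : ZMod 2)) := by
        unfold forms
        rw [Finset.image_image]
        rfl
      rw [himg]
      exact span_singles (VI T I)
    -- δ over the contracted span is ≤ 0 on subsets of X \ I
    have hdef' : ∀ K ⊆ X \ I, deltaS T (spanS Ψ') K ≤ 0 := by
      intro K hK
      have hdisj : Disjoint I K :=
        Finset.disjoint_left.mpr
          (fun j hjI hjK => (Finset.mem_sdiff.mp (hK hjK)).2 hjI)
      rw [hspan', deltaS_contract T S hdisj]
      have hIK : I ∪ K ∈ X.powerset := by
        rw [Finset.mem_powerset]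
        exact Finset.union_subset hIX (fun j hj => (Finset.mem_sdiff.mp (hK hj)).1)
      have := hImax (I ∪ K) hIK
      omega
    -- the criterion satisfies X \ I over Ψ'
    have hsat' := transversal_criterion T a Ψ' ⟨z, hz'⟩ (X \ I) hdef'
    obtain ⟨z', hz'Sol, hz'Sat⟩ := hsat'
    have hz'Ψ : z' ∈ Sol Ψ := by
      rw [hΨ', Sol_union] at hz'Sol
      exact hz'Sol.1
    have hagree : ∀ i ∈ VI T I, z' i = z i := by
      intro i hi
      have hpE : (Pi.single i 1, z i) ∈ E := by
        rw [hE]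
        exact Finset.mem_image_of_mem _ hi
      have hz'E : z' ∈ Sol E := by
        rw [hΨ', Sol_union] at hz'Sol
        exact hz'Sol.2
      have := hz'E _ hpE
      rwa [single_dotProduct, one_mul] at this
    -- z' satisfies X = I ∪ (X \ I)
    have hz'SatX : SatOn T a X z' := by
      intro j hj
      by_cases hjI : j ∈ I
      · obtain ⟨i, hiT, hine⟩ := hzSat j hjI
        refine ⟨i, hiT, ?_⟩
        rw [hagree i (subset_VI T hjI hiT)]
        exact hine
      · exact hz'Sat j (Finset.mem_sdiff.mpr ⟨hj, hjI⟩)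
    exact hmin.1 ⟨z', hz'Ψ, hz'SatX⟩
  -- Step 2: a maximiser exists and must be X itself
  obtain ⟨I, hI, hImax⟩ := Finset.exists_max_image X.powerset (deltaS T S)
    ⟨∅, Finset.empty_mem_powerset X⟩
  have hIeqX : I = X := by
    by_contra hne
    have hss : I ⊂ X :=
      lt_of_le_of_ne (Finset.mem_powerset.mp hI) hne
    exact key I hI hImax (hmin.2 I hss)
  have hmax : ∀ J ∈ X.powerset, deltaS T S J ≤ deltaS T S X := by
    intro J hJ
    have := hImax J hJ
    rwa [hIeqX] at this
  have huniq : ∀ J ⊂ X, deltaS T S J < deltaS T S X := by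
    intro J hJ
    rcases lt_or_eq_of_le (hmax J (Finset.mem_powerset.mpr hJ.subset)) with h | h
    · exact h
    · exfalso
      have hJmax : ∀ J' ∈ X.powerset, deltaS T S J' ≤ deltaS T S J :=
        fun J' hJ' => (hmax J' hJ').trans h.ge
      exact key J (Finset.mem_powerset.mpr hJ.subset) hJmax (hmin.2 J hJ)
  have hXne : X.Nonempty := by
    by_contra hXe
    rw [Finset.not_nonempty_iff_eq_empty] at hXe
    obtain ⟨z, hz⟩ := hcons
    refine hmin.1 ⟨z, hz, ?_⟩
    rw [hXe]
    exact fun j hj => absurd hj (Finset.notMem_empty j)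
  constructor
  · have h0 := huniq ∅ (Finset.empty_ssubset.mpr hXne)
    rw [deltaS_empty] at h0
    omega
  · intro J hJ
    have := huniq J hJ
    omega

/-- The RANK FORM used by the Res(⊕) argument: for a consistent system `Ψ` and a minimally
`Ψ`-unsatisfiable clause set `X`, `|V(X)| + 1 ≤ |X| + dim ⟨L(Ψ)⟩` (indeed
`dim(⟨L(Ψ)⟩ ∩ 𝔽₂^{V(X)}) ≥ |V(X)| - |X| + 1`). -/
theorem card_VI_succ_le_card_add_finrank (Ψ : AffSys V) (hcons : (Sol Ψ).Nonempty)
    (X : Finset ι) (hmin : MinimalPsiUnsat T a Ψ X) :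
    (VI T X).card + 1 ≤ X.card + finrank (ZMod 2) (spanS Ψ) := by
  have h := (linear_aharoni_linial T a Ψ hcons X hmin).1
  rw [deltaS] at h
  have hle : finrank (ZMod 2) (spanS Ψ ⊓ coordS (VI T X) : Submodule (ZMod 2) (V → ZMod 2)) ≤
      finrank (ZMod 2) (spanS Ψ) := Submodule.finrank_mono inf_le_left
  omega

end CriterionLAL

end ResLinRank

end Summit.PneNP.PneNP.Theorems
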